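import Mathlib
import Literature.MathematicalPhysics.KineticTheory.Hilbert6Wave0
import Literature.MathematicalPhysics.KineticTheory.HardSphereEuler

/-!
# Sketch — crux-ideate stmt-AtomisticToContinuum-9518 (`CollisionalTransferLocality`), round 1,
ideator 1 (gen 2): first lemmas of the two idea cards

* card `young-contact-normals-adm-average` : `capFlatness` (PROVED), `DiskToHemisphereCosineLaw`
  (typed; the impact-disc ↔ cosine-law dictionary), `oneFlightMagnification_statement` (typed).
* card `moment-sector-ring-gain` : `covariance_defect` (PROVED: the isometric transfer turns
  ancestor anisotropy LINEARLY into partner cross-covariance and returns exactly `θ δ_ij 𝟙` at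
  isotropy), `IsotropicKickSecondMoment`, `CmCovarianceHalf` (typed).

Everything is over existing declarations: `Literature.MathematicalPhysics.KineticTheory.sphereMeasure`,
`…collide`, Mathlib matrices / Hausdorff measure / Bochner integrals.
-/

namespace Summit.AtomisticToContinuum.HydrodynamicLimit.Cruxes.CollisionalTransferLocality.IdeatorOneG2

open MeasureTheory Metric Real Matrix
open scoped InnerProductSpace BigOperators

noncomputable section

/-- Velocity space `ℝ³`. -/
abbrev V3 : Type := EuclideanSpace ℝ (Fin 3)

/-! ## Card A — young contact normals -/

/-- **Cap flatness** (the contraction step of one-flight defocusing, elementary): a positive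
function on the unit sphere whose logarithm is `κ`-Lipschitz varies by a factor at most
`exp (2 κ α)` over any cap of (chordal) radius `α`.  Applied with `α ≍ ε/L` (the cap of outgoing
directions that hit one target sphere at distance `L`) it says that the conditional law of the
impact point on that target is flat up to `e^{±2κε/L}`. -/
theorem capFlatness (q : sphere (0 : V3) 1 → ℝ) (κ α : ℝ)
    (hq : ∀ n, 0 < q n)
    (hlip : ∀ n n' : sphere (0 : V3) 1, |Real.log (q n) - Real.log (q n')| ≤ κ * dist n n')
    (c n n' : sphere (0 : V3) 1) (hn : dist n c ≤ α) (hn' : dist n' c ≤ α) (hκ : 0 ≤ κ) :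
    q n ≤ Real.exp (2 * κ * α) * q n' := by
  have h1 : Real.log (q n) - Real.log (q n') ≤ κ * dist n n' :=
    (le_abs_self _).trans (hlip n n')
  have h2 : dist n n' ≤ 2 * α := by
    calc dist n n' ≤ dist n c + dist c n' := dist_triangle _ _ _
      _ ≤ α + α := add_le_add hn (by rwa [dist_comm] at hn')
      _ = 2 * α := by ring
  have h3 : Real.log (q n) ≤ Real.log (q n') + 2 * κ * α := by
    have := mul_le_mul_of_nonneg_left h2 hκ
    linarith
  calc q n = Real.exp (Real.log (q n)) := (Real.exp_log (hq n)).symm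
    _ ≤ Real.exp (Real.log (q n') + 2 * κ * α) := Real.exp_le_exp.mpr h3
    _ = Real.exp (2 * κ * α) * q n' := by
        rw [Real.exp_add, Real.exp_log (hq n'), mul_comm]

/-- **Impact disc ↔ cosine law** (the dictionary between "uniform impact parameter" and the
Boltzmann–Enskog `((w−v)·ω)₊ dω` weight; Soto 2016 §3.3 p. 72 "b = R sin θ … |c·n̂| d²n̂"): for a unit
vector `g` (direction of the relative velocity of the incoming pair) the map
`b ↦ ω(b) = b − √(1−|b|²) g` sends the unit disc orthogonal to `g`, with its two-dimensional
(Hausdorff) area measure, onto the incoming hemisphere `{g·ω < 0}` with the flux measure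
`(−g·ω)₊ dσ(ω)`.  Typed as an integral identity for continuous bounded test functions. -/
def DiskToHemisphereCosineLaw : Prop :=
  ∀ (g : V3), ‖g‖ = 1 → ∀ (F : V3 → ℝ), Continuous F → (∃ C, ∀ x, |F x| ≤ C) →
    ∫ ω, F (ω : V3) * max (-(⟪g, (ω : V3)⟫_ℝ)) 0
        ∂(Literature.MathematicalPhysics.KineticTheory.sphereMeasure (E := V3))
      = ∫ b in {b : V3 | ⟪b, g⟫_ℝ = 0 ∧ ‖b‖ < 1},
          F (b - Real.sqrt (1 - ‖b‖ ^ 2) • g) ∂(Measure.hausdorffMeasure 2 : Measure V3)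

/-- **One-flight magnification** (typed; the geometric-optics fact behind "contact normals are
young", Dorfman 1999 (18.1)–(18.2): a pencil leaving a sphere of radius `a` has radius of curvature
`ρ₊ ≤ a cos φ / 2 ≤ a/2`, and a free flight of length `L` magnifies transverse separations by
`1 + L/ρ₊ ≥ 1 + 2L/a`).  Elementary form used by the line: two rays from one point `x` with unit
directions `n, n'` are, after length `L`, at distance `L‖n − n'‖` — so a target disc of radius `ε`
at distance `L` is hit from a cap of directions of chordal radius `≤ ε / L` (up to the factor
controlling obliquity). -/
def OneFlightMagnification : Prop :=
  ∀ (x : V3) (n n' : V3) (L : ℝ), ‖n‖ = 1 → ‖n'‖ = 1 → 0 ≤ L →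
    dist (x + L • n) (x + L • n') = L * ‖n - n'‖

/-- `OneFlightMagnification` holds (two lines of normed-space algebra). -/
theorem oneFlightMagnification_holds : OneFlightMagnification := by
  intro x n n' L _ _ hL
  rw [dist_eq_norm, add_sub_add_left_eq_sub, ← smul_sub, norm_smul, Real.norm_of_nonneg hL]

/-! ## Card B — moment-sector ring gain -/

/-- **Covariance-defect identity** (the algebraic heart of the ring-gain loop).  Let `M i k` be the
`3 × 3` blocks of an isometric velocity transfer (`Σₖ M_ik M_jkᵀ = δ_ij 𝟙`, the certified
cross-row orthogonality of route CollisionIsometryCLT's frozen-geometry transfer) and let `S k` be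
ANY assignment of ancestor covariance blocks.  Then the present cross-covariance
`Σₖ M_ik S_k M_jkᵀ` differs from the chaotic isotropic value `θ δ_ij 𝟙` by the transfer of the
ANISOTROPY DEFECTS `S_k − θ𝟙` only: it vanishes identically when every ancestor block is `θ𝟙`
(whatever the non-Gaussian shape of the ancestor laws) and is linear in the defects otherwise. -/
theorem covariance_defect {n : ℕ} (M : Fin n → Fin n → Matrix (Fin 3) (Fin 3) ℝ)
    (S : Fin n → Matrix (Fin 3) (Fin 3) ℝ) (θ : ℝ)
    (horth : ∀ i j : Fin n, ∑ k, M i k * (M j k)ᵀ = if i = j then 1 else 0) (i j : Fin n) :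
    ∑ k, M i k * S k * (M j k)ᵀ - (if i = j then θ • (1 : Matrix (Fin 3) (Fin 3) ℝ) else 0)
      = ∑ k, M i k * (S k - θ • (1 : Matrix (Fin 3) (Fin 3) ℝ)) * (M j k)ᵀ := by
  have key : ∑ k, M i k * (θ • (1 : Matrix (Fin 3) (Fin 3) ℝ)) * (M j k)ᵀ
      = if i = j then θ • (1 : Matrix (Fin 3) (Fin 3) ℝ) else 0 := by
    have : ∀ k, M i k * (θ • (1 : Matrix (Fin 3) (Fin 3) ℝ)) * (M j k)ᵀ
        = θ • (M i k * (M j k)ᵀ) := by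
      intro k
      rw [Matrix.mul_smul, Matrix.mul_one, Matrix.smul_mul]
    simp_rw [this, ← Finset.smul_sum, horth]
    split_ifs <;> simp
  simp_rw [Matrix.mul_sub, Matrix.sub_mul, Finset.sum_sub_distrib, key]

/-- **Isotropic kick, second moment** (typed): averaging `(V + r n) ⊗ (V + r n)` over a uniformly
distributed unit vector `n` gives `V ⊗ V + (r²/3) 𝟙` — with a FRESH (flux-uniform) impact parameter
a hard-sphere collision redistributes the relative velocity uniformly on the sphere (Soto 2016
§3.3 p. 72 / §10 p. 295), so the post-collisional one-body traceless second moment is that of the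
centre-of-mass velocity alone. (`|S²|` = total mass of `sphereMeasure`.) -/
def IsotropicKickSecondMoment : Prop :=
  ∀ (V : V3) (r : ℝ) (a b : Fin 3),
    ∫ n, (V a + r * (n : V3) a) * (V b + r * (n : V3) b)
        ∂(Literature.MathematicalPhysics.KineticTheory.sphereMeasure (E := V3))
      = ((Literature.MathematicalPhysics.KineticTheory.sphereMeasure (E := V3)) Set.univ).toReal
          * (V a * V b + if a = b then r ^ 2 / 3 else 0)

/-- **Centre-of-mass covariance is one half** (typed): under a product law `μ ⊗ μ` with finite
second moments the covariance matrix of `(v + v')/2` is half the covariance matrix of `μ` — the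
"anisotropy halves per fresh collision" step (number-weighted; flux-weighting corrections vanish
for Gaussian `μ`, for which `V` and `v − v'` are independent). -/
def CmCovarianceHalf : Prop :=
  ∀ (μ : Measure V3), IsProbabilityMeasure μ → Integrable (fun v : V3 => ‖v‖ ^ 2) μ →
    ∀ a b : Fin 3,
      ∫ p : V3 × V3, (((1 / 2 : ℝ) • (p.1 + p.2)) a - (∫ v, v ∂μ) a)
          * (((1 / 2 : ℝ) • (p.1 + p.2)) b - (∫ v, v ∂μ) b) ∂(μ.prod μ)
        = (1 / 2 : ℝ) * ∫ v : V3, (v a - (∫ w, w ∂μ) a) * (v b - (∫ w, w ∂μ) b) ∂μ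

end

end Summit.AtomisticToContinuum.HydrodynamicLimit.Cruxes.CollisionalTransferLocality.IdeatorOneG2
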